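import Mathlib.MeasureTheory.Integral.Prod
import Mathlib.MeasureTheory.Integral.Bochner.Set
import Mathlib.MeasureTheory.Measure.Lebesgue.Basic
import Mathlib.Probability.Notation
import HarnessLib

/-!
# Route `ColdStartUniversality`, rung `stub_fixedCutoffMixing` of K_A1 (stmt-QuantumFields-24809):
# freezing a Lipschitz coefficient at the left end of a cell

Helper file (seat `ym-line-csu-p1`, g6) for the `WilsonMeasureLangevinInvariant` wall of the rung
(step 2, Taylor route to Dynkin's formula in expectation).  The main terms of the second-order
Taylor expansion over a cell `(u, v]` have the coefficient `ψ(X_u)` FROZEN at the left end point,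
while the generator integrand has `ψ(X_r)`; the difference is controlled by the Lipschitz constant
of `ψ` and the mean oscillation of `X` over the cell:

* `abs_integral_freeze_sub_le` — for `|Z| ≤ C`, `|c| ≤ Mc` (jointly measurable), `ψ` bounded and
  `Lψ`-Lipschitz for the `ℓ¹` distance, and `E|X_{r,l} - X_{u,l}| ≤ ρ` for `r ∈ (u, v]`,
  `|E[Z ψ(X_u) ∫_{(u,v]} c_r dr] - E[Z ∫_{(u,v]} ψ(X_r) c_r dr]| ≤ C Mc Lψ |ι| ρ (v - u)`
  (Fubini on `Ω × (u, v]`).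

Pure measure theory (no stochastic input); no definition, no sorry, standard axioms.  RECORD-rung
plumbing (R3); the Yang–Mills mass gap is NOT proved.
-/

set_option autoImplicit false

noncomputable section

namespace Summit.QuantumFields.YangMills.Theorems.ColdStartUniversality

open MeasureTheory ProbabilityTheory Filter Finset
open scoped NNReal ENNReal Topology

variable {Ω : Type*} {mΩ : MeasurableSpace Ω} {P : Measure Ω} [IsProbabilityMeasure P]
  {ι : Type*} [Fintype ι]

/-- **Freezing a Lipschitz coefficient at the left end of a cell.**  Let `X : ℝ≥0 → Ω → (ι → ℝ)` be
jointly measurable with integrable increments and mean oscillation `E|X_{r,l} - X_{u,l}| ≤ ρ` for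
`r ∈ (u, v]`; `c` jointly measurable with `|c| ≤ Mc`; `ψ` continuous, `|ψ| ≤ Cψ` and
`|ψ y - ψ y'| ≤ Lψ ∑_l |y_l - y'_l|`; `Z` measurable with `|Z| ≤ C`.  Then
`|E[Z ψ(X_u) ∫_{(u,v]} c_r dr] - E[Z ∫_{(u,v]} ψ(X_r) c_r dr]| ≤ C Mc Lψ |ι| ρ (v - u)`. [folklore] -/
theorem abs_integral_freeze_sub_le {X : ℝ≥0 → Ω → (ι → ℝ)} {c : ℝ≥0 → Ω → ℝ} {ψ : (ι → ℝ) → ℝ}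
    {Z : Ω → ℝ} {C Mc Cψ Lψ ρ : ℝ} {u v : ℝ≥0} (huv : u ≤ v)
    (hXm : ∀ l, Measurable fun p : Ω × ℝ ↦ X p.2.toNNReal p.1 l)
    (hXint : ∀ l (r : ℝ≥0), Integrable (fun ω ↦ X r ω l - X u ω l) P)
    (hXρ : ∀ l (r : ℝ), r ∈ Set.Ioc (u : ℝ) v → ∫ ω, |X r.toNNReal ω l - X u ω l| ∂P ≤ ρ)
    (hcm : Measurable fun p : Ω × ℝ ↦ c p.2.toNNReal p.1) (hcM : ∀ r ω, |c r ω| ≤ Mc)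
    (hψc : Continuous ψ) (hψB : ∀ y, |ψ y| ≤ Cψ) (hLψ : 0 ≤ Lψ)
    (hψL : ∀ y y', |ψ y - ψ y'| ≤ Lψ * ∑ l, |y l - y' l|)
    (hZm : Measurable Z) (hC : ∀ ω, |Z ω| ≤ C) :
    |∫ ω, Z ω * ψ (X u ω) * (∫ r in Set.Ioc (u : ℝ) v, c r.toNNReal ω) ∂P -
        ∫ ω, Z ω * (∫ r in Set.Ioc (u : ℝ) v, ψ (X r.toNNReal ω) * c r.toNNReal ω) ∂P| ≤
      C * Mc * Lψ * (Fintype.card ι) * ρ * ((v : ℝ) - u) := by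
  -- nonnegativity of the constants
  obtain ⟨ω₀, -⟩ := nonempty_of_measure_ne_zero (μ := P) (s := Set.univ)
    (by rw [measure_univ]; exact one_ne_zero)
  have hC0 : 0 ≤ C := (abs_nonneg _).trans (hC ω₀)
  have hMc0 : 0 ≤ Mc := (abs_nonneg _).trans (hcM 0 ω₀)
  have hCψ0 : 0 ≤ Cψ := (abs_nonneg _).trans (hψB (X u ω₀))
  have hδ0 : 0 ≤ (v : ℝ) - u := sub_nonneg.2 (NNReal.coe_le_coe.2 huv)
  set ν : Measure ℝ := volume.restrict (Set.Ioc (u : ℝ) v) with hν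
  haveI : IsFiniteMeasure ν := by
    rw [hν]; exact ⟨by rw [Measure.restrict_apply_univ, Real.volume_Ioc]; exact ENNReal.ofReal_lt_top⟩
  have hνuniv : ν.real Set.univ = (v : ℝ) - u := by
    rw [hν, measureReal_restrict_apply_univ, Real.volume_real_Ioc_of_le (NNReal.coe_le_coe.2 huv)]
  -- measurability
  have hXu : ∀ l, Measurable fun ω ↦ X u ω l := fun l ↦ by
    have h := (hXm l).comp (measurable_id.prodMk (measurable_const (a := (u : ℝ))))
    simpa [Function.comp_def, Real.toNNReal_coe] using h
  have hXvec : Measurable fun p : Ω × ℝ ↦ X p.2.toNNReal p.1 := measurable_pi_lambda _ hXm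
  have hXuvec : Measurable fun ω ↦ X u ω := measurable_pi_lambda _ hXu
  have hψXr : Measurable fun p : Ω × ℝ ↦ ψ (X p.2.toNNReal p.1) := hψc.measurable.comp hXvec
  have hψXu : Measurable fun ω ↦ ψ (X u ω) := hψc.measurable.comp hXuvec
  have hDm : ∀ l, Measurable fun p : Ω × ℝ ↦ |X p.2.toNNReal p.1 l - X u p.1 l| := fun l ↦
    continuous_abs.measurable.comp ((hXm l).sub ((hXu l).comp measurable_fst))
  -- the integrand of the difference on the product `Ω × (u, v]` and its dominating function
  set F : Ω × ℝ → ℝ := fun p ↦ Z p.1 * ((ψ (X u p.1) - ψ (X p.2.toNNReal p.1)) * c p.2.toNNReal p.1)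
    with hF
  have hFm : Measurable F :=
    (hZm.comp measurable_fst).mul (((hψXu.comp measurable_fst).sub hψXr).mul hcm)
  set G : Ω × ℝ → ℝ := fun p ↦ ∑ l, |X p.2.toNNReal p.1 l - X u p.1 l| with hG
  have hGm : Measurable G := Finset.measurable_sum _ fun l _ ↦ hDm l
  have hG0 : ∀ p, 0 ≤ G p := fun p ↦ sum_nonneg fun l _ ↦ abs_nonneg _
  have hFle : ∀ p, |F p| ≤ C * Mc * Lψ * G p := by
    intro p
    have h1 : |ψ (X u p.1) - ψ (X p.2.toNNReal p.1)| ≤ Lψ * G p := by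
      refine (hψL _ _).trans (le_of_eq ?_)
      rw [hG]
      exact congrArg (Lψ * ·) (sum_congr rfl fun l _ ↦ abs_sub_comm _ _)
    have e : |F p| = |Z p.1| * (|ψ (X u p.1) - ψ (X p.2.toNNReal p.1)| * |c p.2.toNNReal p.1|) := by
      rw [hF]; simp only [abs_mul]
    rw [e]
    calc |Z p.1| * (|ψ (X u p.1) - ψ (X p.2.toNNReal p.1)| * |c p.2.toNNReal p.1|)
        ≤ C * ((Lψ * G p) * Mc) :=
          mul_le_mul (hC _) (mul_le_mul h1 (hcM _ _) (abs_nonneg _)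
            (mul_nonneg hLψ (hG0 p))) (mul_nonneg (abs_nonneg _) (abs_nonneg _)) hC0
      _ = C * Mc * Lψ * G p := by ring
  -- integrability on the product
  have hDint : ∀ l, Integrable (fun p : Ω × ℝ ↦ |X p.2.toNNReal p.1 l - X u p.1 l|) (P.prod ν) := by
    intro l
    rw [integrable_prod_iff' (hDm l).aestronglyMeasurable]
    constructor
    · exact ae_of_all _ fun r ↦ (hXint l r.toNNReal).abs
    · refine Integrable.mono' (integrable_const ρ) ?_
        (ae_restrict_of_forall_mem measurableSet_Ioc fun r hr ↦ ?_)
      · exact ((hDm l).norm.stronglyMeasurable.integral_prod_left' ).aestronglyMeasurable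
      · rw [Real.norm_eq_abs, abs_of_nonneg (integral_nonneg fun ω ↦ norm_nonneg _)]
        simpa only [Real.norm_eq_abs, abs_abs] using hXρ l r hr
  have hGint : Integrable G (P.prod ν) := integrable_finsetSum _ fun l _ ↦ hDint l
  have hFint : Integrable F (P.prod ν) :=
    (hGint.const_mul (C * Mc * Lψ)).mono' hFm.aestronglyMeasurable
      (ae_of_all _ fun p ↦ by rw [Real.norm_eq_abs]; exact hFle p)
  -- pathwise integrability of the two time integrands
  have hcint : ∀ ω, Integrable (fun r : ℝ ↦ c r.toNNReal ω) ν := fun ω ↦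
    (integrable_const Mc).mono' (hcm.comp measurable_prodMk_left).aestronglyMeasurable
      (ae_of_all _ fun r ↦ by rw [Real.norm_eq_abs]; exact hcM _ _)
  have hψcint : ∀ ω, Integrable (fun r : ℝ ↦ ψ (X r.toNNReal ω) * c r.toNNReal ω) ν := fun ω ↦
    (integrable_const (Cψ * Mc)).mono' ((hψXr.comp measurable_prodMk_left).mul
      (hcm.comp measurable_prodMk_left)).aestronglyMeasurable
      (ae_of_all _ fun r ↦ by
        rw [Real.norm_eq_abs, abs_mul]
        exact mul_le_mul (hψB _) (hcM _ _) (abs_nonneg _) hCψ0)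
  -- rewrite the difference as `∫∫ F`
  have hinner : ∀ ω, Z ω * ψ (X u ω) * (∫ r in Set.Ioc (u : ℝ) v, c r.toNNReal ω) -
      Z ω * (∫ r in Set.Ioc (u : ℝ) v, ψ (X r.toNNReal ω) * c r.toNNReal ω) = ∫ r, F (ω, r) ∂ν := by
    intro ω
    have e1 : ψ (X u ω) * (∫ r in Set.Ioc (u : ℝ) v, c r.toNNReal ω) =
        ∫ r in Set.Ioc (u : ℝ) v, ψ (X u ω) * c r.toNNReal ω := (integral_const_mul _ _).symm
    have e2 : (∫ r in Set.Ioc (u : ℝ) v, ψ (X u ω) * c r.toNNReal ω) -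
        (∫ r in Set.Ioc (u : ℝ) v, ψ (X r.toNNReal ω) * c r.toNNReal ω) =
        ∫ r in Set.Ioc (u : ℝ) v, (ψ (X u ω) - ψ (X r.toNNReal ω)) * c r.toNNReal ω := by
      rw [← integral_sub ((hcint ω).const_mul _) (hψcint ω)]
      refine integral_congr_ae (ae_of_all _ fun r ↦ ?_)
      ring
    calc Z ω * ψ (X u ω) * (∫ r in Set.Ioc (u : ℝ) v, c r.toNNReal ω) -
          Z ω * (∫ r in Set.Ioc (u : ℝ) v, ψ (X r.toNNReal ω) * c r.toNNReal ω)
        = Z ω * ((∫ r in Set.Ioc (u : ℝ) v, ψ (X u ω) * c r.toNNReal ω) -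
            ∫ r in Set.Ioc (u : ℝ) v, ψ (X r.toNNReal ω) * c r.toNNReal ω) := by rw [← e1]; ring
      _ = Z ω * ∫ r in Set.Ioc (u : ℝ) v, (ψ (X u ω) - ψ (X r.toNNReal ω)) * c r.toNNReal ω := by rw [e2]
      _ = ∫ r, F (ω, r) ∂ν := by rw [hF, ← integral_const_mul]
  -- integrability of the two expectations
  have hI1 : Integrable (fun ω ↦ Z ω * ψ (X u ω) * ∫ r in Set.Ioc (u : ℝ) v, c r.toNNReal ω) P := by
    have hm : AEStronglyMeasurable (fun ω ↦ ∫ r in Set.Ioc (u : ℝ) v, c r.toNNReal ω) P :=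
      (hcm.stronglyMeasurable.integral_prod_right' (ν := ν)).aestronglyMeasurable
    refine (integrable_const (C * Cψ * (Mc * ((v : ℝ) - u)))).mono'
      ((hZm.aestronglyMeasurable.mul hψXu.aestronglyMeasurable).mul hm) (ae_of_all _ fun ω ↦ ?_)
    rw [Real.norm_eq_abs, abs_mul, abs_mul]
    have hb : |∫ r in Set.Ioc (u : ℝ) v, c r.toNNReal ω| ≤ Mc * ((v : ℝ) - u) := by
      have h := norm_setIntegral_le_of_norm_le_const (μ := volume) (s := Set.Ioc (u : ℝ) v)
        (f := fun r : ℝ ↦ c r.toNNReal ω) (C := Mc) (by rw [Real.volume_Ioc]; exact ENNReal.ofReal_lt_top)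
        (fun r _ ↦ by rw [Real.norm_eq_abs]; exact hcM _ _)
      rw [Real.volume_real_Ioc_of_le (NNReal.coe_le_coe.2 huv), Real.norm_eq_abs] at h
      linarith
    exact mul_le_mul (mul_le_mul (hC ω) (hψB _) (abs_nonneg _) hC0) hb (abs_nonneg _)
      (mul_nonneg hC0 hCψ0)
  have hI2 : Integrable (fun ω ↦ Z ω * ∫ r in Set.Ioc (u : ℝ) v, ψ (X r.toNNReal ω) * c r.toNNReal ω) P := by
    have hm : AEStronglyMeasurable
        (fun ω ↦ ∫ r in Set.Ioc (u : ℝ) v, ψ (X r.toNNReal ω) * c r.toNNReal ω) P :=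
      ((hψXr.mul hcm).stronglyMeasurable.integral_prod_right' (ν := ν)).aestronglyMeasurable
    refine (integrable_const (C * (Cψ * Mc * ((v : ℝ) - u)))).mono' (hZm.aestronglyMeasurable.mul hm)
      (ae_of_all _ fun ω ↦ ?_)
    rw [Real.norm_eq_abs, abs_mul]
    have hb : |∫ r in Set.Ioc (u : ℝ) v, ψ (X r.toNNReal ω) * c r.toNNReal ω| ≤
        Cψ * Mc * ((v : ℝ) - u) := by
      have h := norm_setIntegral_le_of_norm_le_const (μ := volume) (s := Set.Ioc (u : ℝ) v)
        (f := fun r : ℝ ↦ ψ (X r.toNNReal ω) * c r.toNNReal ω) (C := Cψ * Mc)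
        (by rw [Real.volume_Ioc]; exact ENNReal.ofReal_lt_top)
        (fun r _ ↦ by
          rw [Real.norm_eq_abs, abs_mul]
          exact mul_le_mul (hψB _) (hcM _ _) (abs_nonneg _) hCψ0)
      rw [Real.volume_real_Ioc_of_le (NNReal.coe_le_coe.2 huv), Real.norm_eq_abs] at h
      linarith
    exact mul_le_mul (hC ω) hb (abs_nonneg _) hC0
  rw [← integral_sub hI1 hI2, integral_congr_ae (ae_of_all _ hinner), ← integral_prod F hFint]
  -- Fubini the other way and the bound
  have hDswap : ∀ l, ∫ p, |X p.2.toNNReal p.1 l - X u p.1 l| ∂(P.prod ν) =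
      ∫ r, (∫ ω, |X r.toNNReal ω l - X u ω l| ∂P) ∂ν := fun l ↦ integral_prod_symm _ (hDint l)
  have hDle : ∀ l, ∫ r, (∫ ω, |X r.toNNReal ω l - X u ω l| ∂P) ∂ν ≤ ρ * ((v : ℝ) - u) := by
    intro l
    have h := integral_mono_of_nonneg (μ := ν) (f := fun r ↦ ∫ ω, |X r.toNNReal ω l - X u ω l| ∂P)
      (g := fun _ ↦ ρ) (ae_of_all _ fun r ↦ integral_nonneg fun ω ↦ abs_nonneg _)
      (integrable_const ρ) (ae_restrict_of_forall_mem measurableSet_Ioc fun r hr ↦ hXρ l r hr)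
    refine h.trans (le_of_eq ?_)
    rw [integral_const, smul_eq_mul, hνuniv, mul_comm]
  calc |∫ p, F p ∂(P.prod ν)| ≤ ∫ p, |F p| ∂(P.prod ν) := by
        simpa only [Real.norm_eq_abs] using norm_integral_le_integral_norm F
    _ ≤ ∫ p, C * Mc * Lψ * G p ∂(P.prod ν) := integral_mono hFint.abs (hGint.const_mul _) hFle
    _ = C * Mc * Lψ * ∑ l, ∫ p, |X p.2.toNNReal p.1 l - X u p.1 l| ∂(P.prod ν) := by
        rw [integral_const_mul, hG, integral_finsetSum _ fun l _ ↦ hDint l]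
    _ ≤ C * Mc * Lψ * ∑ _l : ι, ρ * ((v : ℝ) - u) := by
        refine mul_le_mul_of_nonneg_left (sum_le_sum fun l _ ↦ ?_) (mul_nonneg (mul_nonneg hC0 hMc0) hLψ)
        rw [hDswap l]; exact hDle l
    _ = C * Mc * Lψ * (Fintype.card ι) * ρ * ((v : ℝ) - u) := by
        rw [sum_const, card_univ, nsmul_eq_mul]; ring

end Summit.QuantumFields.YangMills.Theorems.ColdStartUniversality

end
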